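import Mathlib
import HarnessLib
import Summits.ValiantsHypothesis.ValiantsHypothesis.Theorems.LacunarySymmetroidMatrixDescartesProductPlusOneTameCalculus

/-!
# ValiantsHypothesis / LacunarySymmetroid — crux `MatrixDescartes` (stmt-ValiantsHypothesis-18050, V1),
# LINE (A) «product_plus_one», floor `OneChangeFloorK3`: the CAPACITY DICTIONARY (chart ↔ logistic currency)

The laws ✓ `…MidSwitching` (riser floor, entry horizon), ✓ `…SingleEpisode(OneSigned)`, ✓ `…ActivityThreshold`, ✓ `…PushLogConcave`
(push/drag log-concavity) are stated for the chart row `g = a + b x^p + c x^q` (`p = e+1`, `q = e+k+2`) in the LOGISTIC currency: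
`S = p b + q c x^{q−p}` (`θg = x^p S`), `Ψ_j = S/g`, `Ψ_j′ = num/g²` (✓ `hasDerivAt_term`), pull numerator `N = −x^p S`, capacity `K = θN/N`,
`μ = K − p`, `κ = θK`, `φ = θg/g`, `δ = μ − φ`.  This file records the closed forms tying the two currencies together, as plain identities over
`ℝ` (no sign hypotheses except non-vanishing denominators):

* `capacity_mu_eq` — `μ = (θN − pN)/N = q(q−p)·c·x^{q−p}/S`;
* `capacity_kappa_eq` — `κ := (N·θ²N − (θN)²)/N² = μ·(q−p−μ)` (cf. ✓ `sepWeight_pull_theta_identities`: `N·θ²N − (θN)² = pq(q−p)²·bc·x^{p+q}`);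
* ★ `x_mul_num_eq` — THE RICCATI DICTIONARY: `x·num = g·S·δ`, i.e. `θΨ_j = Ψ_j·δ` — the chart numerator `num` IS the logistic lag form
  (`num > 0 ⟺` the row pushes up `⟺ S·g·δ > 0`, which for a switched incoherent row (`S<0`, `g<0`) means `δ > 0`);
* `hasDerivAt_mu` — calculus wiring `θμ = κ`: `HasDerivAt (μ as a function of x) (κ/x) x`.

HONEST FRAMING: bookkeeping identities; closes NO stub; NOT `OneChangeFloorK3` / the stubs / `MatrixDescartes`; `VP ≠ VNP` is NOT proved.
No definitions, no named facts, no sorry; Mathlib + ✓ `…TameCalculus`.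

[folklore] Quotient rule and polynomial identities; no citation needed.
-/

set_option linter.dupNamespace false

namespace Summit.ValiantsHypothesis.ValiantsHypothesis.Theorems.LacunarySymmetroidMatrixDescartes

namespace ProductPlusOne

/-- **`μ` closed form**: with `N = −(p b x^p + q c x^q)`, `θN = −(p² b x^p + q² c x^q)`:
`(θN − p·N)·S = q(q−p)·c·x^{q−p}·N`, i.e. `μ = q(q−p) c x^{q−p}/S` off `S = 0`. [folklore] -/
theorem capacity_mu_eq (b c : ℝ) (e k : ℕ) (x : ℝ) :
    (-((e + 1 : ℝ) ^ 2 * b * x ^ (e + 1) + (e + k + 2 : ℝ) ^ 2 * c * x ^ (e + k + 2))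
        - (e + 1 : ℝ) * -((e + 1 : ℝ) * b * x ^ (e + 1) + (e + k + 2 : ℝ) * c * x ^ (e + k + 2)))
        * ((e + 1 : ℝ) * b + (e + k + 2 : ℝ) * c * x ^ (k + 1))
      = ((e + k + 2 : ℝ) * (k + 1 : ℝ) * c * x ^ (k + 1))
        * -((e + 1 : ℝ) * b * x ^ (e + 1) + (e + k + 2 : ℝ) * c * x ^ (e + k + 2)) := by
  ring

/-- **`κ` closed form**: `N·θ²N − (θN)² = μS·((q−p)S − μS)/… `; concretely, with `M := q(q−p) c x^{q−p}` (so `μ = M/S`):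
`(N·θ²N − (θN)²)·S² = N²·M·((q−p)·S − M)`, i.e. `κ = μ(q−p−μ)`. [folklore] -/
theorem capacity_kappa_eq (b c : ℝ) (e k : ℕ) (x : ℝ) :
    ((-((e + 1 : ℝ) * b * x ^ (e + 1) + (e + k + 2 : ℝ) * c * x ^ (e + k + 2)))
          * (-((e + 1 : ℝ) ^ 3 * b * x ^ (e + 1) + (e + k + 2 : ℝ) ^ 3 * c * x ^ (e + k + 2)))
        - (-((e + 1 : ℝ) ^ 2 * b * x ^ (e + 1) + (e + k + 2 : ℝ) ^ 2 * c * x ^ (e + k + 2))) ^ 2)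
        * ((e + 1 : ℝ) * b + (e + k + 2 : ℝ) * c * x ^ (k + 1)) ^ 2
      = (-((e + 1 : ℝ) * b * x ^ (e + 1) + (e + k + 2 : ℝ) * c * x ^ (e + k + 2))) ^ 2
        * (((e + k + 2 : ℝ) * (k + 1 : ℝ) * c * x ^ (k + 1))
          * ((k + 1 : ℝ) * ((e + 1 : ℝ) * b + (e + k + 2 : ℝ) * c * x ^ (k + 1))
            - (e + k + 2 : ℝ) * (k + 1 : ℝ) * c * x ^ (k + 1))) := by
  ring

/-- ★ **THE RICCATI DICTIONARY `x·num = g·S·δ`**: with `δ = μ − φ = q(q−p)c x^{q−p}/S − x^p S/g` (off `S = 0`, `g = 0`),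
`x·num = g·S·δ`; polynomial form: `x·num = q(q−p)c x^{q−p}·g − x^p·S²`. [folklore] -/
theorem x_mul_num_eq (a b c : ℝ) (e k : ℕ) (x : ℝ) :
    x * (((e + k + 2 : ℝ) * c * ((k + 1 : ℝ) * x ^ k)) * (a + b * x ^ (e + 1) + c * x ^ (e + k + 2))
        - ((e + 1 : ℝ) * b + (e + k + 2 : ℝ) * c * x ^ (k + 1))
          * (b * ((e + 1 : ℝ) * x ^ e) + c * ((e + k + 2 : ℝ) * x ^ (e + k + 1))))
      = ((e + k + 2 : ℝ) * (k + 1 : ℝ) * c * x ^ (k + 1)) * (a + b * x ^ (e + 1) + c * x ^ (e + k + 2))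
        - x ^ (e + 1) * ((e + 1 : ℝ) * b + (e + k + 2 : ℝ) * c * x ^ (k + 1)) ^ 2 := by
  ring

/-- **Calculus wiring `θμ = κ`**: `μ(y) = q(q−p) c y^{q−p}/S(y)` has derivative `κ/x = μ(q−p−μ)/x` at `x > 0` (`S(x) ≠ 0`). [folklore] -/
theorem hasDerivAt_mu (b c : ℝ) (e k : ℕ) {x : ℝ} (hx : 0 < x) (hS : (e + 1 : ℝ) * b + (e + k + 2 : ℝ) * c * x ^ (k + 1) ≠ 0) :
    HasDerivAt (fun y : ℝ => (e + k + 2 : ℝ) * (k + 1 : ℝ) * c * y ^ (k + 1) / ((e + 1 : ℝ) * b + (e + k + 2 : ℝ) * c * y ^ (k + 1)))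
      ((((e + k + 2 : ℝ) * (k + 1 : ℝ) * c * x ^ (k + 1)) / ((e + 1 : ℝ) * b + (e + k + 2 : ℝ) * c * x ^ (k + 1))
        * ((k + 1 : ℝ) - ((e + k + 2 : ℝ) * (k + 1 : ℝ) * c * x ^ (k + 1)) / ((e + 1 : ℝ) * b + (e + k + 2 : ℝ) * c * x ^ (k + 1)))) / x) x := by
  have hnum : HasDerivAt (fun y : ℝ => (e + k + 2 : ℝ) * (k + 1 : ℝ) * c * y ^ (k + 1))
      ((e + k + 2 : ℝ) * (k + 1 : ℝ) * c * ((k + 1 : ℕ) * x ^ k)) x :=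
    (hasDerivAt_pow (k + 1) x).const_mul _
  have hden : HasDerivAt (fun y : ℝ => (e + 1 : ℝ) * b + (e + k + 2 : ℝ) * c * y ^ (k + 1))
      ((e + k + 2 : ℝ) * c * ((k + 1 : ℕ) * x ^ k)) x :=
    ((hasDerivAt_pow (k + 1) x).const_mul _).const_add _
  have h := hnum.div hden hS
  refine h.congr_deriv ?_
  have hxk : x ^ (k + 1) = x * x ^ k := by rw [pow_succ]; ring
  field_simp
  push_cast
  ring

end ProductPlusOne

end Summit.ValiantsHypothesis.ValiantsHypothesis.Theorems.LacunarySymmetroidMatrixDescartes
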